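import Literature.AnabelianGeometry.EtaleTheta.FrobenioidThetaOfBiKummerData
import Literature.AlgebraicGeometry.Frobenioids.ModelFrobenioidPreSteps

/-!
# [EtTh] §5 / Prop. 4.3 (iii) for the ASSEMBLED §5 data: the bi-Kummer difference is `μ_N(B_N)`-valued (pp. 317, 331 / PDF pp. 91, 105)

Mochizuki, *The étale theta function …*, Publ. RIMS **45** (2009)
[cite: MochizukiEtTh2009, Prop 4.3 (iii) p.317 (PDF p.91); §5 p.331 (PDF p.105)].  Seat abc-iut-L2-t4 (§5 owner), merge row
W3-L2-01 «§5 GENUINE DATA», PROOF-ONLY sequel of `FrobenioidThetaOfBiKummerData.lean`.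

For the §5 data `ofBiKummerData …` (assembled from abc-iut-L2-t3's §4 setting, an `N`-th root `R` of the fraction-pair of an
`l`-th root of `Θ̈`, abc-iut-L2-t2's `ThetaEnvData`, …) the named §5 input `BiKummerDifferenceMem` — "the difference
`s^⊓-gp_N · (s^⊔-gp_N)⁻¹` determines a twisted homomorphism `H_{B_N} → μ_N(B_N)`" (Prop. 4.3 (iii), p.317 (PDF p.91), for the
bi-Kummer `N`-th root of p.331 (PDF p.105)) — is PROVED (`biKummerDifferenceMem_ofBiKummerData`), by the computation of
abc-iut-L6-t12's `Discharge/Sec4BiKummerRoots.lean` (there for abc-iut-L2-t3's `BiKummerRoot` data; here for the unique lifts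
`s^⊓-gp_N, s^⊔-gp_N` of p.331, whose commutation relations hold by `sgpCapSpec_ofBiKummerData` / `sgpCupSpec_ofBiKummerData`):
the rational function of `s^⊓-gp_N(h) · s^⊔-gp_N(h)⁻¹` is the Kummer cocycle `(τ·f_N)/f_N` of the root `f_N = s^⊓_N · (s^⊔_N)⁻¹`,
`τ = s^trv_N(h')`, whose `N`-th power is `(τ · f|_{A_N})/f|_{A_N} = 1` because `τ` lies over `H_⊙` (`Π^tp_Ÿ ⊆ H_⊙`, input `hH`:
print's "`A_⊙` … defined by the trivial line bundle over `Ÿ`", p.322 (PDF p.96), so `H_⊙ = Π^tp_Ÿ`) and `f|_{A_N}` is `H_{A_N}`-fixed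
(`(N, H_⊙, f|_{A_N})`-saturation of the `N`-domain, Def. 4.1 (iii), carried by `R`).  Inputs: the section property of `σ`
([FrdI] Prop. 5.6), and the [FrdI] Thm. 5.2 (ii) dictionary laws `hfrac`/`haut` of `toB` (identities for abc-iut-L2-t9's
`mkOfModel`, `Discharge/Sec4Model.lean`); `Φ` divisorial / `B` group-like come from `ModelFrobenioid.Hypotheses`.  Consequence:
the bundle `Facts` of §5 named inputs for the assembled data follows from `ConstantsActByCyclotome` (Lemma 5.8, arithmetic
step) ALONE (`facts_ofBiKummerData'`).  Also, generically: `SgpCupSection` from `SgpCupSpec` + `StrvSection`.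
HONEST FRAMING: kernel-checked consequences for data so constructed; nothing of [EtTh] is asserted unconditionally; no side is
taken on anything downstream.
-/

noncomputable section

namespace Literature.AnabelianGeometry.EtaleTheta

open CategoryTheory Opposite Literature.AlgebraicGeometry.Frobenioids
open Literature.AlgebraicGeometry.Frobenioids.PreFrobenioid (pull_injective)

universe u₀ v₀ u v w w' v' u' u''

namespace ThetaFrobenioid

/-! ### Generic: `s^⊔-gp_N` is a section over `H_{B_N}` -/

section Generic

variable {C : Type u'} [Category.{v'} C] {D : Type u''} [Category.{w'} D] (𝔉 : ThetaFrobenioid.{w} C D)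

/-- **`(s^⊔-gp_N(h))^bs = h`** from the defining relation `SgpCupSpec` and the section property of `s^trv_N` — the `s^⊔`-analogue
of `sgpCapSection_of` (apply `(−)^bs` to `s^⊔_N ≫ s^⊔-gp_N(h) = s^trv_N(h') ≫ s^⊔_N` and conjugate by `(s^⊔_N)^bs = (s^⊓_N)^bs`).
[cite: MochizukiEtTh2009, §5 p.331 (PDF p.105)] -/
theorem sgpCupSection_of_spec (hcup : 𝔉.SgpCupSpec) (hstrv : 𝔉.StrvSection) : 𝔉.SgpCupSection := by
  intro hh
  obtain ⟨g', hg'⟩ := 𝔉.autBaseIsoAB.surjective (hh : Aut (𝔉.base.obj 𝔉.BN))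
  have key := congrArg 𝔉.base.map (hcup hh)
  rw [Functor.map_comp, Functor.map_comp, ← hg', MulEquiv.symm_apply_apply, ← 𝔉.base_map_sCap] at key
  have hs : 𝔉.base.map (𝔉.strv g').hom = g'.hom := congrArg Iso.hom (hstrv g')
  rw [hs] at key
  apply Aut.ext
  rw [← hg']
  change 𝔉.base.map (𝔉.sgpCup hh).hom = (𝔉.baseIsoAB.conjAut g').hom
  rw [Iso.conjAut_hom, Iso.conj_apply]
  exact (Iso.eq_inv_comp 𝔉.baseIsoAB).mpr key

/-- The bi-Kummer difference lies in `O^×(B_N) = Ker(Aut_C(B_N) → Aut_D(B_N^bs))` as soon as both sections lie over `H_{B_N}`.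
[cite: MochizukiEtTh2009, Prop 4.3 (iii) p.317 (PDF p.91)] -/
theorem sgpCup_mul_sgpCap_inv_mem_units (hsec : 𝔉.SgpCapSection) (hcs : 𝔉.SgpCupSection) (hh : 𝔉.HB) :
    𝔉.sgpCup hh * (𝔉.sgpCap (hh : Aut (𝔉.base.obj 𝔉.BN)))⁻¹ ∈ 𝔉.units 𝔉.BN := by
  rw [units_eq_ker, MonoidHom.mem_ker, map_mul, map_inv, hcs, hsec, mul_inv_cancel]

end Generic

/-! ### The Kummer computation for `ofBiKummerData` -/

section Kummer

variable {K : Type u₀} [Field K] {X : SemiGraphs.TemperedArithmeticGroup.{u₀} K} {D₀ : Type u₀} [Category.{v₀} D₀]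
  {V : FrdIMonoidStub.{w}} {T₀ : RealifiedDivisorMonoids (D₀ := D₀) V} {D : Type u} [Category.{v} D]
  {VD : FrdICatStub.{u, v, w} D} {S : BiKummerSetting X T₀ D VD}
  {pullFrac : ∀ {A A' : S.C} (_ : A' ⟶ A), S.biratUnits A → S.biratUnits A'}
  {lv N : ℕ+} {T : ThetaEnvData.{max v w} N} {θ : S.biratUnits S.Aodot} {Bl : S.C}
  {Pl : S.FractionPair θ Bl} {Rl : S.NthRoot θ Pl lv pullFrac}
  (h : ModelFrobenioid.Hypotheses S.tf.divisorMonoid S.tf.ratFnFunctor)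
  (toB : ∀ A : S.C, S.biratUnits A →* S.tf.biratUnitsModel A) (Q : FrobenioidTheta.ThetaSubquotientStub.{w} D)
  (odd_l : Odd (lv : ℕ)) (R : S.NthRoot Rl.root Rl.pair N pullFrac) (ιX : T.PiX ≃ₜ* X.Pi)
  (hopen : IsOpen ((S.galoisSurj R.AN.base R.αData.isGalois).ker : Set X.Pi)) (σ : Aut R.AN.base →* Aut R.AN)
  (K' : Type w) [Field K'] (constEmb : K'ˣ →* S.tf.biratUnitsModel R.BN)
  (constEmb_injective : Function.Injective constEmb)
  (hdivc : ∀ g : Aut R.BN.base,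
    ModelFrobenioid.div ((σ ((BiKummerSetting.NthRoot.baseIso S R).conjAut.symm g)).hom ≫ R.pair.num) =
      ModelFrobenioid.div R.pair.num)
  (hdivp : ∀ y : T.PiYdd,
    ModelFrobenioid.div ((σ (S.galoisSurj R.AN.base R.αData.isGalois (ιX y.1))).hom ≫ R.pair.den) =
      ModelFrobenioid.div R.pair.den)

/-- `SgpCupSection` for the assembled data (from the theorem `SgpCupSpec` and the section property of `σ`).
[cite: MochizukiEtTh2009, §5 p.331 (PDF p.105)] -/
theorem sgpCupSection_ofBiKummerData (hσ : ∀ g : Aut R.AN.base, ModelFrobenioid.baseMap (σ g).hom = g.hom) :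
    (ofBiKummerData h toB Q odd_l R ιX hopen σ K' constEmb constEmb_injective hdivc hdivp).SgpCupSection :=
  sgpCupSection_of_spec _ (sgpCupSpec_ofBiKummerData h toB Q odd_l R ιX hopen σ K' constEmb constEmb_injective hdivc hdivp)
    (strvSection_ofBiKummerData h toB Q odd_l R ιX hopen σ K' constEmb constEmb_injective hdivc hdivp hσ)

/-- `s^trv_N(h')` for `h' ∈ H_{A_N}` coming from `Π^tp_Ÿ ⊆ H_⊙` lies in abc-iut-L2-t3's `H_{A_N} ⊆ Aut_C(A_N)` (Def. 4.1 (ii): the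
inverse image of `H_{A_N}^bs = Im(H_⊙ → Aut_D(A_N^bs))`), by the section property of `σ`.
[cite: MochizukiEtTh2009, Def 4.1 (ii) p.313 (PDF p.87)] -/
theorem strv_mem_HA (hσ : ∀ g : Aut R.AN.base, ModelFrobenioid.baseMap (σ g).hom = g.hom)
    (hH : ∀ y : T.PiX, y ∈ T.PiYdd → ιX y ∈ S.Hodot) (y : T.PiX) (hy : y ∈ T.PiYdd) :
    σ (S.galoisSurj R.AN.base R.αData.isGalois (ιX y)) ∈ S.HA R.AN R.αData.isGalois := by
  rw [BiKummerSetting.HA, Subgroup.mem_comap]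
  have hb : S.autBase R.AN (σ (S.galoisSurj R.AN.base R.αData.isGalois (ιX y))) =
      S.galoisSurj R.AN.base R.αData.isGalois (ιX y) := Aut.ext (hσ _)
  rw [hb]
  exact Subgroup.mem_map_of_mem _ (hH y hy)

/-- **The Kummer-cocycle identity** for the assembled data (Prop. 4.3 (iii), "follows immediately from the definitions", p.317
(PDF p.91)): with `x` the rational function of the root `f_N = s^⊓_N·(s^⊔_N)⁻¹` (via `toB`), `τ = s^trv_N(h')` and `b = (s^⊓_N)^bs`,
`b^* u_{s^⊓-gp_N(h)} · x = τ^* x · b^* u_{s^⊔-gp_N(h)}` in `B(A_N^bs)` — adapted from abc-iut-L6-t12's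
`BiKummerRoot.pull_unit_sNum_mul_root`.  [cite: MochizukiEtTh2009, Prop 4.3 (iii) p.317 (PDF p.91)] -/
theorem pull_unit_sgpCap_mul_root
    (hfrac : ∀ {A B : S.C} (s' s'' : A ⟶ B) (h' : S.IsPreStep s') (h'' : S.IsPreStep s'')
      (hb : PreFrobenioid.BaseEquivalent S.F s' s''),
      (toB A (S.fracOf s' s'' h' h'' hb) : S.tf.ratFnFunctor.obj (op A.base)) *
        ModelFrobenioid.unit s'' = ModelFrobenioid.unit s')
    (y : T.PiX) (hy : y ∈ T.PiYdd) :
    pull S.tf.ratFnFunctor (ModelFrobenioid.baseMap R.pair.num)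
        (ModelFrobenioid.unit ((ofBiKummerData h toB Q odd_l R ιX hopen σ K' constEmb constEmb_injective hdivc hdivp).sgpCap
          (rhoOfBiKummerData R ιX y)).hom) * (toB R.AN R.root : S.tf.ratFnFunctor.obj (op R.AN.base)) =
      pull S.tf.ratFnFunctor (ModelFrobenioid.baseMap (σ (S.galoisSurj R.AN.base R.αData.isGalois (ιX y))).hom)
          (toB R.AN R.root : S.tf.ratFnFunctor.obj (op R.AN.base)) *
        pull S.tf.ratFnFunctor (ModelFrobenioid.baseMap R.pair.num)
          (ModelFrobenioid.unit ((ofBiKummerData h toB Q odd_l R ιX hopen σ K' constEmb constEmb_injective hdivc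
            hdivp).sgpCup ⟨rhoOfBiKummerData R ιX y, Subgroup.mem_map_of_mem _ hy⟩).hom) := by
  haveI : IsCancelMul (S.tf.ratFnFunctor.obj (op R.AN.base)) :=
    isIntegral_iff_isCancelMul.mp (h.isGroupLike_rat R.AN.base).isPreDivisorial.isIntegral
  set 𝔉 := ofBiKummerData h toB Q odd_l R ιX hopen σ K' constEmb constEmb_injective hdivc hdivp with h𝔉
  set τ := σ (S.galoisSurj R.AN.base R.αData.isGalois (ιX y)) with hτ
  have hb : ModelFrobenioid.baseMap R.pair.num = ModelFrobenioid.baseMap R.pair.den := R.pair.base_eq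
  have hn1 : ModelFrobenioid.degFr R.pair.num = 1 := R.pair.isPreStep_num.1
  have hd1 : ModelFrobenioid.degFr R.pair.den = 1 := R.pair.isPreStep_den.1
  have hx := hfrac R.pair.num R.pair.den R.pair.isPreStep_num R.pair.isPreStep_den R.pair.base_eq
  rw [R.pair.frac_eq] at hx
  -- the two commutation relations, with `autBaseIsoAB.symm (ρ y) = galoisSurj (ιX y)`
  have hg' : 𝔉.autBaseIsoAB.symm (rhoOfBiKummerData R ιX y) = S.galoisSurj R.AN.base R.αData.isGalois (ιX y) :=
    ofBiKummerData_autBaseIsoAB_symm_ρ h toB Q odd_l R ιX hopen σ K' constEmb constEmb_injective hdivc hdivp y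
  have c1 : R.pair.num ≫ (𝔉.sgpCap (rhoOfBiKummerData R ιX y)).hom = τ.hom ≫ R.pair.num := by
    have e := sgpCapSpec_ofBiKummerData h toB Q odd_l R ιX hopen σ K' constEmb constEmb_injective hdivc hdivp
      (rhoOfBiKummerData R ιX y)
    rw [hg'] at e
    exact e
  have c2 : R.pair.den ≫ (𝔉.sgpCup ⟨rhoOfBiKummerData R ιX y, Subgroup.mem_map_of_mem _ hy⟩).hom =
      τ.hom ≫ R.pair.den := by
    have e := sgpCupSpec_ofBiKummerData h toB Q odd_l R ιX hopen σ K' constEmb constEmb_injective hdivc hdivp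
      ⟨rhoOfBiKummerData R ιX y, Subgroup.mem_map_of_mem _ hy⟩
    rw [hg'] at e
    exact e
  -- units of the two commutation relations
  have e1 := congrArg ModelFrobenioid.unit c1
  have e2 := congrArg ModelFrobenioid.unit c2
  rw [ModelFrobenioid.unit_comp_of_degFr_eq_one _ (ModelFrobenioid.degFr_eq_one_of_isIso _),
    ModelFrobenioid.unit_comp_pull, hn1, PNat.one_coe, pow_one] at e1
  rw [ModelFrobenioid.unit_comp_of_degFr_eq_one _ (ModelFrobenioid.degFr_eq_one_of_isIso _),
    ModelFrobenioid.unit_comp_pull, hd1, PNat.one_coe, pow_one, ← hb] at e2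
  apply mul_right_cancel (b := ModelFrobenioid.unit R.pair.den)
  calc pull S.tf.ratFnFunctor (ModelFrobenioid.baseMap R.pair.num)
          (ModelFrobenioid.unit (𝔉.sgpCap (rhoOfBiKummerData R ιX y)).hom) *
          (toB R.AN R.root : S.tf.ratFnFunctor.obj (op R.AN.base)) * ModelFrobenioid.unit R.pair.den
        = pull S.tf.ratFnFunctor (ModelFrobenioid.baseMap R.pair.num)
          (ModelFrobenioid.unit (𝔉.sgpCap (rhoOfBiKummerData R ιX y)).hom) * ModelFrobenioid.unit R.pair.num := by
          rw [mul_assoc, hx]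
    _ = pull S.tf.ratFnFunctor (ModelFrobenioid.baseMap τ.hom) (ModelFrobenioid.unit R.pair.num) *
          ModelFrobenioid.unit τ.hom := e1
    _ = pull S.tf.ratFnFunctor (ModelFrobenioid.baseMap τ.hom) (toB R.AN R.root : S.tf.ratFnFunctor.obj (op R.AN.base)) *
          (pull S.tf.ratFnFunctor (ModelFrobenioid.baseMap τ.hom) (ModelFrobenioid.unit R.pair.den) *
            ModelFrobenioid.unit τ.hom) := by
          rw [← hx, map_mul, mul_assoc]
    _ = pull S.tf.ratFnFunctor (ModelFrobenioid.baseMap τ.hom) (toB R.AN R.root : S.tf.ratFnFunctor.obj (op R.AN.base)) *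
          (pull S.tf.ratFnFunctor (ModelFrobenioid.baseMap R.pair.num)
            (ModelFrobenioid.unit (𝔉.sgpCup ⟨rhoOfBiKummerData R ιX y, Subgroup.mem_map_of_mem _ hy⟩).hom) *
            ModelFrobenioid.unit R.pair.den) := by rw [← e2]
    _ = _ := by rw [mul_assoc]

/-- **Prop. 4.3 (iii), `N`-torsion, for the assembled data**: `(s^⊓-gp_N(h) · s^⊔-gp_N(h)⁻¹)^N = 1` for `h ∈ H_{B_N}` —
`τ = s^trv_N(h')` lies in `H_{A_N}` (`hH`: `Π^tp_Ÿ ⊆ H_⊙`; section property `hσ`), so it fixes `f|_{A_N} = f_N^N` (the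
saturation clause of the root datum `R`, Def. 4.1 (iii)), and the Kummer cocycle of `f_N` is `N`-torsion; [FrdI] Thm. 5.2 (ii)
dictionary laws `hfrac`, `haut`.  Adapted from abc-iut-L6-t12's `BiKummerRoot.sNum_mul_sDen_inv_pow_eq_one`.
[cite: MochizukiEtTh2009, Prop 4.3 (iii) p.317 (PDF p.91); §5 p.331 (PDF p.105)] -/
theorem sgpCap_mul_sgpCup_inv_pow_eq_one (hσ : ∀ g : Aut R.AN.base, ModelFrobenioid.baseMap (σ g).hom = g.hom)
    (hH : ∀ y : T.PiX, y ∈ T.PiYdd → ιX y ∈ S.Hodot)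
    (hfrac : ∀ {A B : S.C} (s' s'' : A ⟶ B) (h' : S.IsPreStep s') (h'' : S.IsPreStep s'')
      (hb : PreFrobenioid.BaseEquivalent S.F s' s''),
      (toB A (S.fracOf s' s'' h' h'' hb) : S.tf.ratFnFunctor.obj (op A.base)) *
        ModelFrobenioid.unit s'' = ModelFrobenioid.unit s')
    (haut : ∀ {A : S.C} (e : Aut A) (x : S.biratUnits A),
      (toB A (S.biratAut A e x) : S.tf.ratFnFunctor.obj (op A.base)) =
        pull S.tf.ratFnFunctor (ModelFrobenioid.baseMap e.inv) (toB A x : S.tf.ratFnFunctor.obj (op A.base)))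
    (y : T.PiX) (hy : y ∈ T.PiYdd) :
    ((ofBiKummerData h toB Q odd_l R ιX hopen σ K' constEmb constEmb_injective hdivc hdivp).sgpCap
          (rhoOfBiKummerData R ιX y) *
        ((ofBiKummerData h toB Q odd_l R ιX hopen σ K' constEmb constEmb_injective hdivc hdivp).sgpCup
          ⟨rhoOfBiKummerData R ιX y, Subgroup.mem_map_of_mem _ hy⟩)⁻¹) ^ (N : ℕ) = 1 := by
  set 𝔉 := ofBiKummerData h toB Q odd_l R ιX hopen σ K' constEmb constEmb_injective hdivc hdivp with h𝔉
  set τ := σ (S.galoisSurj R.AN.base R.αData.isGalois (ιX y)) with hτ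
  set hh : 𝔉.HB := ⟨rhoOfBiKummerData R ιX y, Subgroup.mem_map_of_mem _ hy⟩ with hhh
  have hstriv : τ ∈ S.HA R.AN R.αData.isGalois := strv_mem_HA R ιX σ hσ hH y hy
  haveI : IsCancelMul (S.tf.ratFnFunctor.obj (op R.AN.base)) :=
    isIntegral_iff_isCancelMul.mp (h.isGroupLike_rat R.AN.base).isPreDivisorial.isIntegral
  haveI : IsCancelMul (S.tf.ratFnFunctor.obj (op 𝔉.BN.base)) :=
    isIntegral_iff_isCancelMul.mp (h.isGroupLike_rat R.BN.base).isPreDivisorial.isIntegral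
  haveI : IsIso (ModelFrobenioid.baseMap R.pair.num) := R.pair.isPreStep_num.2
  -- the Kummer-cocycle identity and its `N`-th power
  have E := pull_unit_sgpCap_mul_root h toB Q odd_l R ιX hopen σ K' constEmb constEmb_injective hdivc hdivp hfrac y hy
  have hxN : (toB R.AN R.root : S.tf.ratFnFunctor.obj (op R.AN.base)) ^ (N : ℕ) =
      (toB R.AN (pullFrac R.αData.α₁ Rl.root) : S.tf.ratFnFunctor.obj (op R.AN.base)) := by
    rw [← Units.val_pow_eq_pow_val, ← map_pow, R.pow_root]
  have hfix : pull S.tf.ratFnFunctor (ModelFrobenioid.baseMap τ.hom)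
      (toB R.AN (pullFrac R.αData.α₁ Rl.root) : S.tf.ratFnFunctor.obj (op R.AN.base)) =
      (toB R.AN (pullFrac R.αData.α₁ Rl.root) : S.tf.ratFnFunctor.obj (op R.AN.base)) := by
    have hmem : τ⁻¹ ∈ S.HA R.AN R.αData.isGalois := Subgroup.inv_mem _ hstriv
    have e : (toB R.AN (S.biratAut R.AN τ⁻¹ (pullFrac R.αData.α₁ Rl.root)) : S.tf.ratFnFunctor.obj (op R.AN.base)) =
        (toB R.AN (pullFrac R.αData.α₁ Rl.root) : S.tf.ratFnFunctor.obj (op R.AN.base)) :=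
      congrArg (fun z : S.biratUnits R.AN => (toB R.AN z : S.tf.ratFnFunctor.obj (op R.AN.base)))
        (R.isSaturated.fixed τ⁻¹ hmem)
    rwa [haut] at e
  have EN := congrArg (fun z => z ^ (N : ℕ)) E
  simp only [mul_pow] at EN
  rw [← map_pow, ← map_pow, ← map_pow, hxN, hfix, mul_comm _ (toB R.AN (pullFrac R.αData.α₁ Rl.root) :
    S.tf.ratFnFunctor.obj (op R.AN.base))] at EN
  have hpow : ModelFrobenioid.unit (𝔉.sgpCap (rhoOfBiKummerData R ιX y)).hom ^ (N : ℕ) =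
      ModelFrobenioid.unit (𝔉.sgpCup hh).hom ^ (N : ℕ) := by
    apply pull_injective (ModelFrobenioid.baseMap R.pair.num)
    exact mul_left_cancel EN
  -- the rational function of `w = s^⊓-gp(h) · s^⊔-gp(h)⁻¹` and of `w^N`
  have hw : 𝔉.sgpCap (rhoOfBiKummerData R ιX y) * (𝔉.sgpCup hh)⁻¹ ∈ 𝔉.units 𝔉.BN := by
    have h1 := sgpCup_mul_sgpCap_inv_mem_units 𝔉
      (sgpCapSection_ofBiKummerData h toB Q odd_l R ιX hopen σ K' constEmb constEmb_injective hdivc hdivp hσ)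
      (sgpCupSection_ofBiKummerData h toB Q odd_l R ιX hopen σ K' constEmb constEmb_injective hdivc hdivp hσ) hh
    have h2 := Subgroup.inv_mem _ h1
    rwa [mul_inv_rev, inv_inv] at h2
  let w' : ModelFrobenioid.units 𝔉.BN := ⟨𝔉.sgpCap (rhoOfBiKummerData R ιX y) * (𝔉.sgpCup hh)⁻¹, hw⟩
  have hu : ModelFrobenioid.unit (𝔉.sgpCap (rhoOfBiKummerData R ιX y) * (𝔉.sgpCup hh)⁻¹).hom *
      pull S.tf.ratFnFunctor (ModelFrobenioid.baseMap (𝔉.sgpCup hh).inv) (ModelFrobenioid.unit (𝔉.sgpCup hh).hom) =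
      pull S.tf.ratFnFunctor (ModelFrobenioid.baseMap (𝔉.sgpCup hh).inv)
        (ModelFrobenioid.unit (𝔉.sgpCap (rhoOfBiKummerData R ιX y)).hom) := by
    have e0 := congrArg ModelFrobenioid.unit (𝔉.sgpCup hh).inv_hom_id
    rw [ModelFrobenioid.unit_comp_of_degFr_eq_one _ (ModelFrobenioid.degFr_eq_one_of_isIso _),
      ModelFrobenioid.unit_id] at e0
    change ModelFrobenioid.unit ((𝔉.sgpCup hh).inv ≫ (𝔉.sgpCap (rhoOfBiKummerData R ιX y)).hom) * _ = _
    rw [ModelFrobenioid.unit_comp_of_degFr_eq_one _ (ModelFrobenioid.degFr_eq_one_of_isIso _), mul_assoc,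
      mul_comm (ModelFrobenioid.unit (𝔉.sgpCup hh).inv), e0, mul_one]
  have huN : ModelFrobenioid.unit (𝔉.sgpCap (rhoOfBiKummerData R ιX y) * (𝔉.sgpCup hh)⁻¹).hom ^ (N : ℕ) = 1 := by
    have e := congrArg (fun z => z ^ (N : ℕ)) hu
    simp only [mul_pow] at e
    rw [← map_pow, ← map_pow, hpow] at e
    exact mul_right_cancel (e.trans (one_mul _).symm)
  -- `O^×(B_N) ↪ B(Base B_N)^×` is injective (`Φ` integral): `w^N = 1`
  have key : ModelFrobenioid.unitsToRatFn 𝔉.BN (w' ^ (N : ℕ)) = ModelFrobenioid.unitsToRatFn 𝔉.BN 1 := by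
    rw [map_pow, map_one]
    apply Units.ext
    rw [Units.val_pow_eq_pow_val, ModelFrobenioid.coe_unitsToRatFn, Units.val_one]
    exact huN
  have hwN := ModelFrobenioid.unitsToRatFn_injective (h.isDivisorial R.BN.base).isPreDivisorial.isIntegral key
  have hfin : ((w' ^ (N : ℕ) : ModelFrobenioid.units 𝔉.BN) : Aut 𝔉.BN) = ((1 : ModelFrobenioid.units 𝔉.BN) : Aut 𝔉.BN) :=
    congrArg Subtype.val hwN
  rw [Subgroup.coe_pow, Subgroup.coe_one] at hfin
  exact hfin

/-- **`BiKummerDifferenceMem` is a THEOREM for the assembled §5 data** ([EtTh] Prop. 4.3 (iii), p.317 (PDF p.91), for the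
bi-Kummer `N`-th root `(s^⊓-gp_N, s^⊔-gp_N)` of p.331 (PDF p.105)): the difference `s^⊔-gp_N(h) · s^⊓-gp_N(h)⁻¹` lies in
`μ_N(B_N)` for every `h ∈ H_{B_N}`.  Inputs: `hσ` ([FrdI] Prop. 5.6), `hH` (`Π^tp_Ÿ ⊆ H_⊙`, p.322 (PDF p.96)), the [FrdI]
Thm. 5.2 (ii) dictionary laws.  [cite: MochizukiEtTh2009, Prop 4.3 (iii) p.317 (PDF p.91); §5 p.331 (PDF p.105)] -/
theorem biKummerDifferenceMem_ofBiKummerData (hσ : ∀ g : Aut R.AN.base, ModelFrobenioid.baseMap (σ g).hom = g.hom)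
    (hH : ∀ y : T.PiX, y ∈ T.PiYdd → ιX y ∈ S.Hodot)
    (hfrac : ∀ {A B : S.C} (s' s'' : A ⟶ B) (h' : S.IsPreStep s') (h'' : S.IsPreStep s'')
      (hb : PreFrobenioid.BaseEquivalent S.F s' s''),
      (toB A (S.fracOf s' s'' h' h'' hb) : S.tf.ratFnFunctor.obj (op A.base)) *
        ModelFrobenioid.unit s'' = ModelFrobenioid.unit s')
    (haut : ∀ {A : S.C} (e : Aut A) (x : S.biratUnits A),
      (toB A (S.biratAut A e x) : S.tf.ratFnFunctor.obj (op A.base)) =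
        pull S.tf.ratFnFunctor (ModelFrobenioid.baseMap e.inv) (toB A x : S.tf.ratFnFunctor.obj (op A.base))) :
    (ofBiKummerData h toB Q odd_l R ιX hopen σ K' constEmb constEmb_injective hdivc hdivp).BiKummerDifferenceMem := by
  rw [biKummerDifferenceMem_iff]
  rintro ⟨x, y, hy, rfl⟩
  exact ⟨by
    have h1 := sgpCup_mul_sgpCap_inv_mem_units _
      (sgpCapSection_ofBiKummerData h toB Q odd_l R ιX hopen σ K' constEmb constEmb_injective hdivc hdivp hσ)
      (sgpCupSection_ofBiKummerData h toB Q odd_l R ιX hopen σ K' constEmb constEmb_injective hdivc hdivp hσ)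
      ⟨rhoOfBiKummerData R ιX y, Subgroup.mem_map_of_mem _ hy⟩
    have h2 := Subgroup.inv_mem _ h1
    rwa [mul_inv_rev, inv_inv] at h2,
    sgpCap_mul_sgpCup_inv_pow_eq_one h toB Q odd_l R ιX hopen σ K' constEmb constEmb_injective hdivc hdivp hσ hH hfrac
      haut y hy⟩

/-- **The bundle `Facts` of §5 named inputs for the assembled data from `ConstantsActByCyclotome` ALONE** (Lemma 5.8, arithmetic
step: Kummer theory over `K`), the remaining six being THEOREMS (defining relations, section property — input `hσ`, [FrdI]
Prop. 5.6 —, Prop. 4.3 (iii), Aut-ampleness, total epimorphicity).  [cite: MochizukiEtTh2009, §5 p.330–331 (PDF pp.104–105)] -/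
theorem facts_ofBiKummerData' (hσ : ∀ g : Aut R.AN.base, ModelFrobenioid.baseMap (σ g).hom = g.hom)
    (hH : ∀ y : T.PiX, y ∈ T.PiYdd → ιX y ∈ S.Hodot)
    (hfrac : ∀ {A B : S.C} (s' s'' : A ⟶ B) (h' : S.IsPreStep s') (h'' : S.IsPreStep s'')
      (hb : PreFrobenioid.BaseEquivalent S.F s' s''),
      (toB A (S.fracOf s' s'' h' h'' hb) : S.tf.ratFnFunctor.obj (op A.base)) *
        ModelFrobenioid.unit s'' = ModelFrobenioid.unit s')
    (haut : ∀ {A : S.C} (e : Aut A) (x : S.biratUnits A),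
      (toB A (S.biratAut A e x) : S.tf.ratFnFunctor.obj (op A.base)) =
        pull S.tf.ratFnFunctor (ModelFrobenioid.baseMap e.inv) (toB A x : S.tf.ratFnFunctor.obj (op A.base)))
    (hK : (ofBiKummerData h toB Q odd_l R ιX hopen σ K' constEmb constEmb_injective hdivc hdivp).ConstantsActByCyclotome) :
    (ofBiKummerData h toB Q odd_l R ιX hopen σ K' constEmb constEmb_injective hdivc hdivp).Facts :=
  facts_ofBiKummerData h toB Q odd_l R ιX hopen σ K' constEmb constEmb_injective hdivc hdivp hσ
    (biKummerDifferenceMem_ofBiKummerData h toB Q odd_l R ιX hopen σ K' constEmb constEmb_injective hdivc hdivp hσ hH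
      hfrac haut) hK

end Kummer

end ThetaFrobenioid

end Literature.AnabelianGeometry.EtaleTheta

end
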